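import Summits.NavierStokesRegularity.FluidComputer.GateBudgetColdBracket
import HarnessLib

/-!
# What no tuning can beat, part 57: THE COLD PHASE, TWO-SIDED — while the trigger of a headline
# member sits below `ρ²/K⁹` after a dousing at clock `-θε` and output pair `P₀`, the pair stays
# within `2(t - T)/K⁹` of `P₀`, the carrier within `[1 - P₀ - 7/K⁹, 1 - P₀ + 6/K⁹]`, the clock
# within `-θε + ε(1 - P₀ ∓ 8/K⁹)(t - T)`, and the clock's unique zero lies in
# `T + [θ/(1 - P₀ + 6/K⁹), θ/(1 - P₀ - 8/K⁹)]` (law 3″ of the θ-drift audit, SPEC-INPUT-bp1 §AZ)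

Cell `pub-fluidc`, blueprint seat bp1 (gen 34, seventh item); same namespace and conventions as
parts 1–56 (`GateBudget*.lean`); imports part 56 (`GateBudgetColdBracket`: the bricks
`knob_pair_dose`, `carrier_bracket`, `clock_bracket`). Headline knob family
`rotorCircuit K K¹⁰ ε ρ` (`σ = ρ²e^{-K¹⁰}`, `μ = ε⁻¹K¹⁰`, `R = ρ⁻²`; modes `0 = a` carrier,
`1 = b` clock, `2 = c` trigger, `3 = d`, `4 = ã`). HONEST FRAMING (verbatim): low prior, high
value-of-information experiment on Tao's machine paradigm; NOT a claim that NS blows up. Nothing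
is proved about the Navier–Stokes equations.

## Why (the audit, SPEC-INPUT-bp1 §AZ)

The misfire ladder of parts 37–47 is a MAP on the entry clock `θ_n` (`b(r_n) = θ_nε` at the
`n`-th ignition). Its cold half was proved ONE-SIDEDLY with frozen absolute constants: cold
window `≥ 2θ` from `a² ≤ 1` (part 44 §131), clock rise `≥ 0.983ε` from `a² ≥ 1 - 1/60 - 4/K¹⁰`
(parts 39/47 §138–§140). Composed, these only give `θ_{n+1} ≥ 0.966·θ_n`, which leaves the
window `[1.265, 1.44]` within three rungs (`1.394 → 1.347 → 1.301 → 1.257`). The factor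
`0.966 = 1 - 2(1 - 0.983)` is the WIDTH of the absolute carrier bracket `[0.983, 1]`, an
artefact: on ONE cold phase the carrier is pinned to `1 - P₀ ± O(1/K⁹)` where `P₀ = d² + ã²`
at the dousing time is RUNG DATA (the pair is frozen while the trigger is small, part 56 §166),
and with a common two-sided bracket the debt repayment and the clock rise are governed by the
SAME slope `ε(1 - P₀)`, so the clock zero sits at `T + θ/(1 - P₀)·(1 ± O(1/K⁹))` and the
re-armed clock returns to `θ(1 ± O(1/K⁹))` — a per-rung drift summable over the ladder.

## What is proved (every constant carried as `c/K⁹`, nothing rounded to an absolute number)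

* §171 `cold_numerics` — at `K ≥ 16`, `ε² ≤ 1/(6K²⁰)`, `K¹⁰ρ² ≤ 2ε`:
  `25ε² + (ρ²/K⁹)² ≤ 1/K⁹` (the trigger-pair allowance `η`) and `ε⁻¹K¹⁰(ρ²/K⁹)² ≤ ε/K⁹`
  (the drag `μc₁²` of a trigger `≤ ρ²/K⁹` on the clock costs at most `1/K⁹` of slope).
* §172 `knob_cold_brackets` — THE COLD PHASE TWO-SIDED: for a member from `delayInit`, a
  time `T ≥ 0` with `b(T) = -θε` (`0 ≤ θ ≤ 3/2`) and pair `P₀ = d(T)² + ã(T)²`, and ANY `u ≤ T + 3`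
  such that `c ≤ ρ²/K⁹` on `[T, u]`: for every `t ∈ [T, u]`,
  `|d² + ã² - P₀| ≤ 2(t - T)/K⁹`, `1 - P₀ - 7/K⁹ ≤ a² ≤ 1 - P₀ + 6/K⁹`, and
  `-θε + ε(1 - P₀ - 8/K⁹)(t - T) ≤ b(t) ≤ -θε + ε(1 - P₀ + 6/K⁹)(t - T)`.
  (The hypothesis `c ≤ ρ²/K⁹ on [T, u]` is discharged on `[T, T + 2θ]` by part 44 §131 and up
  to the relight time by the DEFINITION of that time as the first return of `c` to `ρ²/K⁹`.)
* §173 `knob_cold_clock_zero` — if moreover `P₀ ≤ 1/2`, `θ > 0` and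
  `T + θ/(1 - P₀ - 8/K⁹) ≤ u`, the clock is strictly increasing on `[T, u]` and its zero `tz`
  satisfies `T + θ/(1 - P₀ + 6/K⁹) ≤ tz ≤ T + θ/(1 - P₀ - 8/K⁹)`.

These are law 3″ of §AZ's corrected successor menu; law 4″ (the two-sided RELIGHT, from part
56 §169/§170 against the clock action and these brackets) and the θ-ledger are the successor's.
-/

noncomputable section

namespace Summit.NavierStokesRegularity.FluidComputer.GateBudget

open Real Set
open Literature.Analysis.FluidPDE.Tao2016AveragedNS

variable {K ε ρ : ℝ} {X : ℝ → Fin 5 → ℝ}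

/-- §171 THE COLD-PHASE NUMERICS at the headline family: the trigger-pair allowance
`25ε² + (ρ²/K⁹)² ≤ 1/K⁹` and the clock drag `μc₁² = ε⁻¹K¹⁰(ρ²/K⁹)² ≤ ε/K⁹`.
[derived: this file §171] -/
theorem cold_numerics (hK : 16 ≤ K) (hε : 0 < ε) (hεK : ε ^ 2 ≤ 1 / (6 * K ^ 20))
    (hρ : 0 < ρ) (hhi : K ^ 10 * ρ ^ 2 ≤ 2 * ε) :
    25 * ε ^ 2 + (ρ ^ 2 / K ^ 9) ^ 2 ≤ 1 / K ^ 9 ∧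
      ε⁻¹ * K ^ 10 * (ρ ^ 2 / K ^ 9) ^ 2 ≤ ε / K ^ 9 := by
  have hK0 : (0 : ℝ) < K := by linarith
  have hK1 : (1 : ℝ) ≤ K := by linarith
  have hK9 : (0 : ℝ) < K ^ 9 := by positivity
  have h11 : (16 : ℝ) ^ 11 ≤ K ^ 11 := pow_le_pow_left₀ (by norm_num) hK 11
  have h19 : (16 : ℝ) ^ 19 ≤ K ^ 19 := pow_le_pow_left₀ (by norm_num) hK 19
  have h29 : (16 : ℝ) ^ 29 ≤ K ^ 29 := pow_le_pow_left₀ (by norm_num) hK 29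
  have e1 : ε ^ 2 * (6 * K ^ 20) ≤ 1 := by rwa [le_div_iff₀ (by positivity)] at hεK
  have hε1 : ε ≤ 1 := by nlinarith [one_le_pow₀ hK1 (n := 20)]
  have r1 : K ^ 10 * ρ ^ 2 ≤ 2 := by linarith
  have hρK : ρ ^ 2 ≤ 2 / K ^ 10 := by rw [le_div_iff₀ (by positivity)]; linarith
  refine ⟨?_, ?_⟩
  · have t1 : 25 * ε ^ 2 ≤ 1 / (2 * K ^ 9) := by
      rw [le_div_iff₀ (by positivity)]
      nlinarith [e1, h11, pow_pos hK0 11, sq_nonneg ε]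
    have t2 : (ρ ^ 2 / K ^ 9) ^ 2 ≤ 1 / (2 * K ^ 9) := by
      have h1 : ρ ^ 2 / K ^ 9 ≤ 2 / K ^ 10 / K ^ 9 := div_le_div_of_nonneg_right hρK hK9.le
      have h2 : (ρ ^ 2 / K ^ 9) ^ 2 ≤ (2 / K ^ 10 / K ^ 9) ^ 2 :=
        pow_le_pow_left₀ (by positivity) h1 2
      refine h2.trans ?_
      rw [div_div, div_pow, div_le_div_iff₀ (by positivity) (by positivity)]
      nlinarith [h29, hK9]
    have e : 1 / (2 * K ^ 9) + 1 / (2 * K ^ 9) = 1 / K ^ 9 := by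
      field_simp
      ring
    linarith
  · have r3 : (K ^ 10 * ρ ^ 2) ^ 2 ≤ (2 * ε) ^ 2 := pow_le_pow_left₀ (by positivity) hhi 2
    have e : ε⁻¹ * K ^ 10 * (ρ ^ 2 / K ^ 9) ^ 2 = (K ^ 10 * ρ ^ 2) ^ 2 / (ε * K ^ 28) := by
      field_simp
    rw [e, div_le_div_iff₀ (by positivity) (by positivity)]
    nlinarith [mul_le_mul_of_nonneg_right r3 hK9.le,
      mul_nonneg (mul_nonneg (sq_nonneg ε) hK9.le) (sub_nonneg.2 h19)]

/-- §172 THE COLD PHASE, TWO-SIDED (law 3″ of SPEC-INPUT-bp1 §AZ): after a dousing at clock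
`b(T) = -θε` with output pair `P₀ = d(T)² + ã(T)²`, and for as long as the trigger sits below
`ρ²/K⁹` (and at most `3` time units), the pair moves by `≤ 2(t - T)/K⁹`, the carrier is
bracketed `1 - P₀ - 7/K⁹ ≤ a² ≤ 1 - P₀ + 6/K⁹`, and the clock is bracketed
`-θε + ε(1 - P₀ - 8/K⁹)(t - T) ≤ b(t) ≤ -θε + ε(1 - P₀ + 6/K⁹)(t - T)` — both sides governed
by the SAME rung datum `1 - P₀`. [derived: this file §172] -/
theorem knob_cold_brackets
    (hX : ∀ t, HasDerivAt X (RotorKnob.rotorCircuit K (K ^ 10) ε ρ (X t)) t)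
    (h0 : X 0 = delayInit) (hK : 16 ≤ K) (hε : 0 < ε) (hεK : ε ^ 2 ≤ 1 / (6 * K ^ 20))
    (hρ : 0 < ρ) (hhi : K ^ 10 * ρ ^ 2 ≤ 2 * ε) {T u θ P₀ : ℝ} (hT : 0 ≤ T)
    (hu : u ≤ T + 3) (hθ : 0 ≤ θ) (hθ2 : θ ≤ 3 / 2) (hbT : X T 1 = -(θ * ε))
    (hP : X T 3 ^ 2 + X T 4 ^ 2 = P₀) (hc : ∀ t ∈ Icc T u, X t 2 ≤ ρ ^ 2 / K ^ 9)
    {t : ℝ} (ht : t ∈ Icc T u) :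
    |X t 3 ^ 2 + X t 4 ^ 2 - P₀| ≤ 2 * (t - T) / K ^ 9 ∧
      (1 - P₀ - 7 / K ^ 9 ≤ X t 0 ^ 2 ∧ X t 0 ^ 2 ≤ 1 - P₀ + 6 / K ^ 9) ∧
      (-(θ * ε) + ε * (1 - P₀ - 8 / K ^ 9) * (t - T) ≤ X t 1 ∧
        X t 1 ≤ -(θ * ε) + ε * (1 - P₀ + 6 / K ^ 9) * (t - T)) := by
  have hK0 : (0 : ℝ) < K := by linarith
  have hK9 : (0 : ℝ) < K ^ 9 := by positivity
  have hi9 : (K ^ 9)⁻¹ ≤ 1 := inv_le_one_of_one_le₀ (one_le_pow₀ (by linarith))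
  obtain ⟨n1, n2⟩ := cold_numerics hK hε hεK hρ hhi
  simp only [div_eq_mul_inv] at n1 n2 hc ⊢
  rw [one_mul] at n1
  have hXf := hX
  rw [RotorKnob.rotorCircuit_eq_fiveGate] at hXf
  have hσ : (0 : ℝ) ≤ ρ ^ 2 * exp (-K ^ 10) := by positivity
  have hμ : (0 : ℝ) ≤ ε⁻¹ * K ^ 10 := by positivity
  have hTu : T ∈ Icc T u := left_mem_Icc.2 (ht.1.trans ht.2)
  -- the pair (part 56 §166 with `d₁ = 1`)
  have hd1 : ∀ r ∈ Icc T u, |X r 3| ≤ 1 := fun r _ => traj_abs_le_one hXf h0 r 3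
  have hρ2 : (ρ ^ 2)⁻¹ * ρ ^ 2 = 1 := inv_mul_cancel₀ (by positivity)
  have hpair : ∀ r ∈ Icc T u, |X r 3 ^ 2 + X r 4 ^ 2 - P₀| ≤ 2 * (r - T) * (K ^ 9)⁻¹ := by
    intro r hr
    have h := knob_pair_dose hX h0 hT hc hd1 hr
    rw [hP] at h
    calc |X r 3 ^ 2 + X r 4 ^ 2 - P₀|
        ≤ 2 * (ρ ^ 2)⁻¹ * (ρ ^ 2 * (K ^ 9)⁻¹) * 1 * (r - T) := h
      _ = 2 * ((ρ ^ 2)⁻¹ * ρ ^ 2) * (r - T) * (K ^ 9)⁻¹ := by ring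
      _ = 2 * (r - T) * (K ^ 9)⁻¹ := by rw [hρ2, mul_one]
  -- the trigger: `0 ≤ c ≤ c₁`, `c² ≤ c₁²`
  have hc0 : ∀ r ∈ Icc T u, 0 ≤ X r 2 := fun r hr => c_nonneg hXf h0 hσ (hT.trans hr.1)
  have hc2 : ∀ r ∈ Icc T u, X r 2 ^ 2 ≤ (ρ ^ 2 * (K ^ 9)⁻¹) ^ 2 := fun r hr =>
    pow_le_pow_left₀ (hc0 r hr) (hc r hr) 2
  -- crude clock bounds from the trivial carrier bracket `[0, 1]`
  have ha01 : ∀ r ∈ Icc T u, (0 : ℝ) ≤ X r 0 ^ 2 ∧ X r 0 ^ 2 ≤ 1 := fun r _ =>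
    ⟨sq_nonneg _, traj_sq_le_one hXf h0 r 0⟩
  have hθε : θ * ε ≤ 3 / 2 * ε := mul_le_mul_of_nonneg_right hθ2 hε.le
  have hθε0 : 0 ≤ θ * ε := mul_nonneg hθ hε.le
  have hcrude : ∀ r ∈ Icc T u, -(5 * ε) ≤ X r 1 ∧ X r 1 ≤ 3 * ε := by
    intro r hr
    obtain ⟨hl, hu'⟩ := clock_bracket hXf hε.le hμ ha01 hc2 hTu hr hr.1
    have hrT : r - T ≤ 3 := by linarith [hr.2]
    have hrT0 : 0 ≤ r - T := by linarith [hr.1]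
    have hdrag : ε⁻¹ * K ^ 10 * (ρ ^ 2 * (K ^ 9)⁻¹) ^ 2 * (r - T) ≤ ε * 3 :=
      mul_le_mul (n2.trans (mul_le_of_le_one_right hε.le hi9)) hrT hrT0 hε.le
    have hrise : ε * (r - T) ≤ ε * 3 := mul_le_mul_of_nonneg_left hrT hε.le
    constructor
    · nlinarith [hl, hdrag, hbT, hθε, hε]
    · nlinarith [hu', hrise, hbT, hθε0]
  -- the trigger-pair allowance `η = 1/K⁹`
  have hη : ∀ r ∈ Icc T u, X r 1 ^ 2 + X r 2 ^ 2 ≤ (K ^ 9)⁻¹ := by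
    intro r hr
    obtain ⟨hl, hu'⟩ := hcrude r hr
    have hb2 : X r 1 ^ 2 ≤ (5 * ε) ^ 2 := sq_le_sq' hl (by linarith [hε.le])
    nlinarith [hb2, hc2 r hr, n1]
  -- the carrier bracket (part 56 §167)
  have hcar : ∀ r ∈ Icc T u,
      1 - P₀ - 7 * (K ^ 9)⁻¹ ≤ X r 0 ^ 2 ∧ X r 0 ^ 2 ≤ 1 - P₀ + 6 * (K ^ 9)⁻¹ := by
    intro r hr
    obtain ⟨hl, hu'⟩ := carrier_bracket hX h0 (hpair r hr) (hη r hr)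
    have h6 : 2 * (r - T) * (K ^ 9)⁻¹ ≤ 6 * (K ^ 9)⁻¹ :=
      mul_le_mul_of_nonneg_right (by linarith [hr.2]) (inv_nonneg.2 hK9.le)
    constructor <;> linarith
  -- the clock bracket (part 56 §168) with the carrier bracket
  obtain ⟨hl, hu'⟩ := clock_bracket hXf hε.le hμ hcar hc2 hTu ht ht.1
  have htT0 : 0 ≤ t - T := by linarith [ht.1]
  have hdrag : ε⁻¹ * K ^ 10 * (ρ ^ 2 * (K ^ 9)⁻¹) ^ 2 * (t - T) ≤ ε * (K ^ 9)⁻¹ * (t - T) :=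
    mul_le_mul_of_nonneg_right n2 htT0
  refine ⟨hpair t ht, hcar t ht, ?_, ?_⟩
  · nlinarith [hl, hdrag, hbT]
  · nlinarith [hu', hbT]

/-- §173 THE CLOCK ZERO, TWO-SIDED: under §172's hypotheses with `P₀ ≤ 1/2`, `θ > 0` and a
window reaching `T + θ/(1 - P₀ - 8/K⁹)`, the clock is strictly increasing on `[T, u]` and its
zero `tz` satisfies `T + θ/(1 - P₀ + 6/K⁹) ≤ tz ≤ T + θ/(1 - P₀ - 8/K⁹)` — the cold-phase length
to the clock zero is `θ/(1 - P₀)` up to a relative error `O(1/K⁹)`. [derived: this file §173] -/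
theorem knob_cold_clock_zero
    (hX : ∀ t, HasDerivAt X (RotorKnob.rotorCircuit K (K ^ 10) ε ρ (X t)) t)
    (h0 : X 0 = delayInit) (hK : 16 ≤ K) (hε : 0 < ε) (hεK : ε ^ 2 ≤ 1 / (6 * K ^ 20))
    (hρ : 0 < ρ) (hhi : K ^ 10 * ρ ^ 2 ≤ 2 * ε) {T u θ P₀ : ℝ} (hT : 0 ≤ T)
    (hu : u ≤ T + 3) (hθ : 0 < θ) (hθ2 : θ ≤ 3 / 2) (hbT : X T 1 = -(θ * ε))
    (hP : X T 3 ^ 2 + X T 4 ^ 2 = P₀) (hc : ∀ t ∈ Icc T u, X t 2 ≤ ρ ^ 2 / K ^ 9)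
    (hP0 : P₀ ≤ 1 / 2) (huz : T + θ / (1 - P₀ - 8 / K ^ 9) ≤ u) :
    StrictMonoOn (fun s => X s 1) (Icc T u) ∧
      ∃ tz, T + θ / (1 - P₀ + 6 / K ^ 9) ≤ tz ∧ tz ≤ T + θ / (1 - P₀ - 8 / K ^ 9) ∧
        X tz 1 = 0 := by
  have hK0 : (0 : ℝ) < K := by linarith
  have hK9 : (0 : ℝ) < K ^ 9 := by positivity
  have h9 : (16 : ℝ) ^ 9 ≤ K ^ 9 := pow_le_pow_left₀ (by norm_num) hK 9
  have h8 : 8 / K ^ 9 ≤ 1 / 4 := by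
    rw [div_le_div_iff₀ hK9 (by norm_num)]; nlinarith [h9]
  have hsl : 0 < 1 - P₀ - 8 / K ^ 9 := by linarith
  have hsu : 0 < 1 - P₀ + 6 / K ^ 9 := by
    have : 0 ≤ 6 / K ^ 9 := by positivity
    linarith
  have hbr := fun r (hr : r ∈ Icc T u) =>
    (knob_cold_brackets hX h0 hK hε hεK hρ hhi hT hu hθ.le hθ2 hbT hP hc hr).2
  obtain ⟨_, n2⟩ := cold_numerics hK hε hεK hρ hhi
  have hXf := hX
  rw [RotorKnob.rotorCircuit_eq_fiveGate] at hXf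
  have hσ : (0 : ℝ) ≤ ρ ^ 2 * exp (-K ^ 10) := by positivity
  have hcont : Continuous fun s => X s 1 := continuous_traj hXf 1
  refine ⟨?_, ?_⟩
  · refine strictMonoOn_of_deriv_pos (convex_Icc T u) hcont.continuousOn fun r hr => ?_
    rw [interior_Icc] at hr
    have hr' : r ∈ Icc T u := Ioo_subset_Icc_self hr
    rw [(hasDerivAt_b hXf r).deriv]
    have ha := (hbr r hr').1.1
    have hc0 : 0 ≤ X r 2 := c_nonneg hXf h0 hσ (hT.trans hr'.1)
    have hc2 : X r 2 ^ 2 ≤ (ρ ^ 2 / K ^ 9) ^ 2 := pow_le_pow_left₀ hc0 (hc r hr') 2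
    have hdrag : ε⁻¹ * K ^ 10 * X r 2 ^ 2 ≤ ε / K ^ 9 :=
      (mul_le_mul_of_nonneg_left hc2 (by positivity)).trans n2
    have hpos : 0 < ε * (1 - P₀ - 8 / K ^ 9) := mul_pos hε hsl
    have e : ε * (1 - P₀ - 8 / K ^ 9) = ε * (1 - P₀ - 7 / K ^ 9) - ε / K ^ 9 := by ring
    nlinarith [mul_le_mul_of_nonneg_left ha hε.le, hdrag, hpos, e]
  · set t₂ := T + θ / (1 - P₀ - 8 / K ^ 9) with ht₂
    have hTt₂ : T ≤ t₂ := by rw [ht₂]; linarith [div_pos hθ hsl]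
    have ht₂u : t₂ ∈ Icc T u := ⟨hTt₂, huz⟩
    have hb₂ : 0 ≤ X t₂ 1 := by
      have h := (hbr t₂ ht₂u).2.1
      have e : ε * (1 - P₀ - 8 / K ^ 9) * (t₂ - T) = θ * ε := by
        rw [ht₂, add_sub_cancel_left, mul_assoc, mul_div_cancel₀ _ hsl.ne', mul_comm]
      linarith
    have hbT' : X T 1 ≤ 0 := by rw [hbT]; nlinarith [hθ, hε]
    obtain ⟨tz, htz, hz⟩ :=
      intermediate_value_Icc hTt₂ hcont.continuousOn ⟨hbT', hb₂⟩
    have hz' : X tz 1 = 0 := by simpa using hz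
    refine ⟨tz, ?_, by simpa [ht₂] using htz.2, hz'⟩
    have h := (hbr tz ⟨htz.1, htz.2.trans huz⟩).2.2
    rw [hz'] at h
    have h1 : θ * ε ≤ ε * (1 - P₀ + 6 / K ^ 9) * (tz - T) := by linarith
    have h2 : θ ≤ (1 - P₀ + 6 / K ^ 9) * (tz - T) := by
      by_contra hlt
      have hlt' := not_le.1 hlt
      nlinarith [mul_lt_mul_of_pos_left hlt' hε]
    have h3 : θ / (1 - P₀ + 6 / K ^ 9) ≤ tz - T := by
      rw [div_le_iff₀ hsu]; linarith
    linarith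

end Summit.NavierStokesRegularity.FluidComputer.GateBudget
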